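import Literature.MathematicalPhysics.QuantumManyBody.BoseEinsteinCondensation
import Mathlib.MeasureTheory.Measure.Lebesgue.Basic
import Mathlib.Algebra.Order.Chebyshev
import HarnessLib

/-!
# The dyadic coherent fraction of an `N`-boson wave function

Topic `Literature/MathematicalPhysics/QuantumManyBody` (definition item `defn-DyadicCoherentFraction`,
wanted by route `BECTangentStates` of `Summits/AtomisticToContinuum/BoseEinsteinCondensation`, items
`stmt-AtomisticToContinuum-6416 … 6421`, which inline the bodies below verbatim).

For a box side `L`, a dyadic level `k : ℕ` and a multi-index `m : Fin 3 → Fin (2^k)` we define, over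
`Literature.MathematicalPhysics.QuantumManyBody.BoseGas` (`Space = ℝ³`, `Config N = (ℝ³)^N`,
`occupation N φ Ψ = ⟨φ, γ_Ψ φ⟩`):

* `dyCell L k m = ∏_j [m_j s, (m_j+1) s)`, `s = L/2^k` — the HALF-OPEN dyadic cell of side `L/2^k`
  with corner `m s` (half-open so that the `8^k` cells of level `k` partition `[0,L)³` exactly and the
  `8` children of a cell partition it exactly);
* `dyMode L k m = (s³)^{-1/2} 1_{dyCell L k m}` — the `L²`-normalised FLAT one-particle mode of the cell;
* `cohSum N L k Ψ = ∑_m ⟨dyMode L k m, γ_Ψ dyMode L k m⟩` — the DYADIC COHERENT SUM: the expected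
  number of particles of `Ψ` found in the flat mode of their own cell of side `L/2^k`;
  `F_k(Ψ) = cohSum / N ∈ [0, 1]` is the dyadic coherent fraction (`F_0` = the constant-mode =
  zero-momentum condensate fraction of the box `[0,L)³`; for the free Dirichlet ground state
  `∏ sin(π xⱼ/L)`: `F_0 = F_1 = (8/π²)³ ≈ 0.533`).

These are the objects behind the scale-resolved condensation criteria "`F_K(Ψ₀) ≥ 1/2` at a fixed
dyadic level `K`" (coarse coherence) used by the route: by pigeonhole one of the `8^K` flat modes then
carries `≥ N/(2·8^K)` particles, which is Bose–Einstein condensation in the sense of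
`HasGroundStateBEC` (largest eigenvalue of `γ_Ψ₀` of order `N`, [LSSY2005, (1.19)]) with `c = 2⁻¹8⁻ᴷ`.
Generalised (local, coarse-grained) condensate fractions of this kind are standard in the
mathematical physics of the dilute Bose gas (localisation of BEC to boxes of the healing/GP scale,
[LSSY2005, Ch. 5–7]; cell decompositions [LSSY2005, §2.2]); the dyadic bookkeeping is [folklore].

## API (all [folklore])

* cells: `mem_dyCell_iff`, `measurableSet_dyCell`, `volume_dyCell` (`= ofReal (L/2^k)^3`),
  `dyCell_eq_empty` (`L ≤ 0`), `disjoint_dyCell` (distinct indices), `iUnion_dyCell`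
  (`⋃_m dyCell L k m = [0,L)³`, the half-open box = `BoseGas.cell L` of `PeriodicBoseGas`),
  `box_subset_iUnion_dyCell` (the open box `BoseGas.box L` is covered: "union = box up to faces");
* modes: `dyMode_of_mem`, `dyMode_of_notMem`, `measurable_dyMode`, `aestronglyMeasurable_dyMode`,
  `lintegral_nnnorm_dyMode_sq` (`∫ |dyMode|² = 1` for `L > 0`), `integral_conj_dyMode_mul`
  (`∫ conj(dyMode) f = (s³)^{-1/2} ∫_{cell} f`);
* sums: `cohSum_eq` (the inlined form of the route items, by `rfl`), `cohSum_zero`,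
  `exists_div_le_occupation_of_le_cohSum` (pigeonhole: `a ≤ cohSum N L K Ψ → ∃ m, a/8^K ≤ ⟨dyMode, γ_Ψ dyMode⟩`)
  and its `ofReal (N/2)` corollary `exists_le_occupation_of_half_le_cohSum` in the exact numerals of
  item `CoarsePigeonhole`.

Refinement monotonicity `cohSum N L k Ψ ≤ cohSum N L (k+1) Ψ`, the Bessel bound `cohSum ≤ N` and
`cohSum N L k Ψ → N` (`k → ∞`) are NOT in this file (they need Fubini over `x ↦ (x, X)` and are filed
separately).

## Design choices

* The bodies of `dyCell`, `dyMode`, `cohSum` are LITERALLY the expressions inlined in the route items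
  (so those items are definitionally equal to statements over these names; `cohSum_eq` is `rfl`).
* This file imports `BoseEinsteinCondensation` only (not `PeriodicBoseGas`), so that routes using it do
  not acquire the named facts of the periodic file in their import cone; `[0,L)³` is therefore written
  out as `{x | ∀ j, x j ∈ Set.Ico 0 L}` (defeq to `BoseGas.cell L`).
* Everything is stated for all `L : ℝ`; for `L ≤ 0` all cells are empty and all modes vanish.

## References

* [LSSY2005] E. H. Lieb, R. Seiringer, J. P. Solovej, J. Yngvason, *The Mathematics of the Bose Gas and
  its Condensation*, Birkhäuser 2005: §1.2 (1.17)–(1.19) (occupation, BEC), §2.2 (cell method),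
  Ch. 5–7 (BEC and the GP scale).
-/

noncomputable section

open MeasureTheory Filter Metric WithLp
open scoped ENNReal NNReal ComplexConjugate

namespace Literature.MathematicalPhysics.QuantumManyBody.BoseGas

/-! ### Dyadic cells -/

/-- The half-open dyadic cell `∏_{j<3} [m_j L/2^k, (m_j+1) L/2^k) ⊂ ℝ³` of level `k` and index
`m ∈ {0,…,2^k-1}³` in the box of side `L` (side `L/2^k`, corner `m L/2^k`). Half-open, so that the
cells of one level are pairwise disjoint and the eight children partition the parent. [folklore] -/
def dyCell (L : ℝ) (k : ℕ) (m : Fin 3 → Fin (2 ^ k)) : Set Space :=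
  {x : EuclideanSpace ℝ (Fin 3) | ∀ j, x j ∈ Set.Ico ((((m j : ℕ) : ℝ)) * (L / 2 ^ k))
    ((((m j : ℕ) : ℝ) + 1) * (L / 2 ^ k))}

/-- The `L²`-normalised flat mode `((L/2^k)³)^{-1/2} · 1_{dyCell L k m}` of a dyadic cell. [folklore] -/
def dyMode (L : ℝ) (k : ℕ) (m : Fin 3 → Fin (2 ^ k)) : Space → ℂ :=
  (dyCell L k m).indicator (fun _ => ((Real.sqrt ((L / 2 ^ k) ^ 3))⁻¹ : ℂ))

/-- The **dyadic coherent sum** `∑_m ⟨dyMode L k m, γ_Ψ dyMode L k m⟩` of an `N`-particle wave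
function `Ψ` at level `k`: the expected number of particles found in the flat mode of their own
dyadic cell of side `L/2^k` (`occupation` = the one-particle density matrix expectation,
[LSSY2005, (1.17)]). `cohSum / N` is the dyadic coherent fraction `F_k(Ψ)`; `k = 0` gives the
constant-mode (zero-momentum) occupation of the box `[0,L)³`. [folklore] -/
def cohSum (N : ℕ) (L : ℝ) (k : ℕ) (Ψ : Config N → ℂ) : ℝ≥0∞ :=
  ∑ m : Fin 3 → Fin (2 ^ k), occupation N (dyMode L k m) Ψ

/-! ### Cells: membership, measurability, volume, partition -/

/-- Membership in a dyadic cell, coordinatewise. [folklore] -/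
theorem mem_dyCell_iff {L : ℝ} {k : ℕ} {m : Fin 3 → Fin (2 ^ k)} {x : Space} :
    x ∈ dyCell L k m ↔ ∀ j, ((m j : ℕ) : ℝ) * (L / 2 ^ k) ≤ x j ∧
      x j < (((m j : ℕ) : ℝ) + 1) * (L / 2 ^ k) :=
  Iff.rfl

/-- A dyadic cell is the preimage of a coordinate box under `ofLp : EuclideanSpace ℝ (Fin 3) → (Fin 3 → ℝ)`.
[folklore] -/
theorem dyCell_eq_preimage (L : ℝ) (k : ℕ) (m : Fin 3 → Fin (2 ^ k)) :
    dyCell L k m = (@ofLp 2 (Fin 3 → ℝ)) ⁻¹' Set.univ.pi fun j =>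
      Set.Ico ((((m j : ℕ) : ℝ)) * (L / 2 ^ k)) ((((m j : ℕ) : ℝ) + 1) * (L / 2 ^ k)) := by
  ext x; simp [dyCell]

/-- Dyadic cells are measurable. [folklore] -/
theorem measurableSet_dyCell (L : ℝ) (k : ℕ) (m : Fin 3 → Fin (2 ^ k)) :
    MeasurableSet (dyCell L k m) := by
  rw [dyCell_eq_preimage]
  exact (MeasurableSet.univ_pi fun _ => measurableSet_Ico).preimage (WithLp.measurable_ofLp 2 _)

/-- `|dyCell L k m| = (L/2^k)³` (as `ofReal (L/2^k) ^ 3`; `0` for `L ≤ 0`). [folklore] -/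
theorem volume_dyCell (L : ℝ) (k : ℕ) (m : Fin 3 → Fin (2 ^ k)) :
    volume (dyCell L k m) = ENNReal.ofReal (L / 2 ^ k) ^ 3 := by
  rw [dyCell_eq_preimage, (PiLp.volume_preserving_ofLp (Fin 3)).measure_preimage
    (MeasurableSet.univ_pi fun _ => measurableSet_Ico).nullMeasurableSet, volume_pi_pi]
  have h : ∀ j : Fin 3, (((m j : ℕ) : ℝ) + 1) * (L / 2 ^ k) - ((m j : ℕ) : ℝ) * (L / 2 ^ k) =
      L / 2 ^ k := fun j => by ring
  simp [Real.volume_Ico, h]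

/-- For `L ≤ 0` every dyadic cell is empty. [folklore] -/
theorem dyCell_eq_empty {L : ℝ} (hL : L ≤ 0) (k : ℕ) (m : Fin 3 → Fin (2 ^ k)) :
    dyCell L k m = ∅ := by
  ext x
  simp only [mem_dyCell_iff, Set.mem_empty_iff_false, iff_false, not_forall]
  refine ⟨0, fun h => ?_⟩
  have hs : L / 2 ^ k ≤ 0 := div_nonpos_of_nonpos_of_nonneg hL (by positivity)
  nlinarith [h.1, h.2]

/-- One-dimensional separation: the half-open intervals `[p s, (p+1) s)` and `[q s, (q+1) s)` with
`p ≠ q` natural are disjoint (empty if `s ≤ 0`). [folklore] -/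
theorem disjoint_Ico_mul_of_ne {p q : ℕ} (h : p ≠ q) (s : ℝ) :
    Disjoint (Set.Ico ((p : ℝ) * s) (((p : ℝ) + 1) * s)) (Set.Ico ((q : ℝ) * s) (((q : ℝ) + 1) * s)) := by
  wlog hpq : p < q generalizing p q
  · exact (this h.symm (lt_of_le_of_ne (not_lt.1 hpq) h.symm)).symm
  have hpq' : (p : ℝ) + 1 ≤ q := by exact_mod_cast hpq
  refine Set.disjoint_left.2 fun t ht ht' => ?_
  rcases le_or_gt 0 s with hs | hs
  · have := mul_le_mul_of_nonneg_right hpq' hs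
    linarith [ht.2, ht'.1]
  · linarith [ht.1, ht.2]

/-- Distinct cells of the same level are disjoint. [folklore] -/
theorem disjoint_dyCell {L : ℝ} {k : ℕ} {m m' : Fin 3 → Fin (2 ^ k)} (h : m ≠ m') :
    Disjoint (dyCell L k m) (dyCell L k m') := by
  obtain ⟨j, hj⟩ := Function.ne_iff.1 h
  refine Set.disjoint_left.2 fun x hx hx' => ?_
  exact Set.disjoint_left.1 (disjoint_Ico_mul_of_ne (Fin.val_ne_of_ne hj) (L / 2 ^ k)) (hx j) (hx' j)

/-- The cells of one level are pairwise disjoint. [folklore] -/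
theorem pairwise_disjoint_dyCell (L : ℝ) (k : ℕ) :
    Pairwise (Function.onFun Disjoint (dyCell L k)) := fun _ _ h =>
  disjoint_dyCell h

/-- The cells of level `k` cover exactly the half-open box `[0, L)³` (`= BoseGas.cell L` of the
periodic set-up; empty for `L ≤ 0`). [folklore] -/
theorem iUnion_dyCell (L : ℝ) (k : ℕ) :
    ⋃ m, dyCell L k m = {x : Space | ∀ j, x j ∈ Set.Ico 0 L} := by
  have h2k : (0 : ℝ) < 2 ^ k := by positivity
  ext x
  simp only [Set.mem_iUnion, mem_dyCell_iff, Set.mem_setOf_eq, Set.mem_Ico]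
  constructor
  · rintro ⟨m, hm⟩ j
    obtain ⟨h1, h2⟩ := hm j
    have hmj : ((m j : ℕ) : ℝ) + 1 ≤ 2 ^ k := by exact_mod_cast (m j).isLt
    rcases le_or_gt 0 L with hL | hL
    · have hs : 0 ≤ L / 2 ^ k := by positivity
      refine ⟨le_trans (by positivity) h1, h2.trans_le ?_⟩
      calc (((m j : ℕ) : ℝ) + 1) * (L / 2 ^ k) ≤ 2 ^ k * (L / 2 ^ k) :=
            mul_le_mul_of_nonneg_right hmj hs
        _ = L := by field_simp
    · exfalso
      have hs : L / 2 ^ k < 0 := div_neg_of_neg_of_pos hL h2k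
      nlinarith
  · intro hx
    have hL : 0 < L := (hx 0).1.trans_lt (hx 0).2
    have hs : 0 < L / 2 ^ k := by positivity
    have hlt : ∀ j, ⌊x j / (L / 2 ^ k)⌋₊ < 2 ^ k := fun j => by
      rw [Nat.floor_lt (div_nonneg (hx j).1 hs.le), div_lt_iff₀ hs]
      push_cast
      rw [mul_div_cancel₀ _ h2k.ne']
      exact (hx j).2
    refine ⟨fun j => ⟨⌊x j / (L / 2 ^ k)⌋₊, hlt j⟩, fun j => ⟨?_, ?_⟩⟩
    · have := Nat.floor_le (div_nonneg (hx j).1 hs.le)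
      simpa [le_div_iff₀ hs] using this
    · have := Nat.lt_floor_add_one (x j / (L / 2 ^ k))
      simpa [div_lt_iff₀ hs] using this

/-- The open box `Λ_L = (0,L)³` is covered by the cells of every level ("union = box up to faces").
[folklore] -/
theorem box_subset_iUnion_dyCell (L : ℝ) (k : ℕ) : box L ⊆ ⋃ m, dyCell L k m := by
  rw [iUnion_dyCell]
  exact fun x hx j => Set.Ioo_subset_Ico_self (hx j)

/-! ### Flat modes -/

/-- The flat mode is the constant `((L/2^k)³)^{-1/2}` on its cell. [folklore] -/
@[simp]
theorem dyMode_of_mem {L : ℝ} {k : ℕ} {m : Fin 3 → Fin (2 ^ k)} {x : Space} (hx : x ∈ dyCell L k m) :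
    dyMode L k m x = ((Real.sqrt ((L / 2 ^ k) ^ 3))⁻¹ : ℂ) :=
  Set.indicator_of_mem hx _

/-- The flat mode vanishes off its cell. [folklore] -/
@[simp]
theorem dyMode_of_notMem {L : ℝ} {k : ℕ} {m : Fin 3 → Fin (2 ^ k)} {x : Space}
    (hx : x ∉ dyCell L k m) : dyMode L k m x = 0 :=
  Set.indicator_of_notMem hx _

/-- Flat modes are measurable. [folklore] -/
theorem measurable_dyMode (L : ℝ) (k : ℕ) (m : Fin 3 → Fin (2 ^ k)) : Measurable (dyMode L k m) :=
  measurable_const.indicator (measurableSet_dyCell L k m)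

/-- Flat modes are a.e. strongly measurable (the measurability demanded by `maxOccupation`). [folklore] -/
theorem aestronglyMeasurable_dyMode (L : ℝ) (k : ℕ) (m : Fin 3 → Fin (2 ^ k)) :
    AEStronglyMeasurable (dyMode L k m) volume :=
  (measurable_dyMode L k m).aestronglyMeasurable

/-- The squared modulus of the flat mode is `(L/2^k)^{-3}` times the indicator of its cell (`L > 0`).
[folklore] -/
theorem nnnorm_dyMode_sq {L : ℝ} (hL : 0 < L) (k : ℕ) (m : Fin 3 → Fin (2 ^ k)) (x : Space) :
    ((‖dyMode L k m x‖₊ : ℝ≥0∞) ^ 2) =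
      (dyCell L k m).indicator (fun _ => ENNReal.ofReal (((L / 2 ^ k) ^ 3)⁻¹)) x := by
  have hs3 : 0 < (L / 2 ^ k) ^ 3 := by positivity
  by_cases hx : x ∈ dyCell L k m
  · rw [dyMode, Set.indicator_of_mem hx, Set.indicator_of_mem hx, ← ENNReal.coe_pow, ENNReal.ofReal,
      ENNReal.coe_inj]
    ext
    rw [NNReal.coe_pow, coe_nnnorm, norm_inv, Complex.norm_real, Real.norm_of_nonneg (Real.sqrt_nonneg _),
      inv_pow, Real.sq_sqrt hs3.le, Real.coe_toNNReal _ (by positivity)]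
  · rw [dyMode, Set.indicator_of_notMem hx, Set.indicator_of_notMem hx]
    simp

/-- Flat modes are `L²`-normalised: `∫ |dyMode L k m|² = 1` for `L > 0`. [folklore] -/
theorem lintegral_nnnorm_dyMode_sq {L : ℝ} (hL : 0 < L) (k : ℕ) (m : Fin 3 → Fin (2 ^ k)) :
    ∫⁻ x, (‖dyMode L k m x‖₊ : ℝ≥0∞) ^ 2 = 1 := by
  have hs : 0 < L / 2 ^ k := by positivity
  simp_rw [nnnorm_dyMode_sq hL]
  rw [lintegral_indicator_const (measurableSet_dyCell L k m), volume_dyCell, ← ENNReal.ofReal_pow hs.le,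
    ← ENNReal.ofReal_mul (by positivity), inv_mul_cancel₀ (by positivity), ENNReal.ofReal_one]

/-- The pairing of a flat mode with a one-particle function is the normalised cell average:
`∫ conj(dyMode L k m) f = ((L/2^k)³)^{-1/2} ∫_{dyCell L k m} f` (no integrability needed: both sides
use the Bochner convention). [folklore] -/
theorem integral_conj_dyMode_mul (L : ℝ) (k : ℕ) (m : Fin 3 → Fin (2 ^ k)) (f : Space → ℂ) :
    ∫ x, conj (dyMode L k m x) * f x =
      ((Real.sqrt ((L / 2 ^ k) ^ 3))⁻¹ : ℂ) * ∫ x in dyCell L k m, f x := by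
  have h : ∀ x, conj (dyMode L k m x) * f x =
      (dyCell L k m).indicator (fun x => ((Real.sqrt ((L / 2 ^ k) ^ 3))⁻¹ : ℂ) * f x) x := by
    intro x
    by_cases hx : x ∈ dyCell L k m
    · rw [dyMode, Set.indicator_of_mem hx, Set.indicator_of_mem hx, ← Complex.ofReal_inv,
        Complex.conj_ofReal]
    · rw [dyMode, Set.indicator_of_notMem hx, Set.indicator_of_notMem hx, map_zero, zero_mul]
  simp_rw [h]
  rw [integral_indicator (measurableSet_dyCell L k m), integral_const_mul]

/-! ### The coherent sum -/

/-- `cohSum` is, by `rfl`, the expression inlined in the route items of `BECTangentStates`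
(`MesoscopicFloor`, `ScaleTransfer`, `CoarsePigeonhole`, `DyadicMonotone`). [folklore] -/
theorem cohSum_eq (N : ℕ) (L : ℝ) (k : ℕ) (Ψ : Config N → ℂ) :
    cohSum N L k Ψ = ∑ m : Fin 3 → Fin (2 ^ k), occupation N
      (({x : EuclideanSpace ℝ (Fin 3) | ∀ j, x j ∈ Set.Ico ((((m j : ℕ) : ℝ)) * (L / 2 ^ k))
        ((((m j : ℕ) : ℝ) + 1) * (L / 2 ^ k))}).indicator
        (fun _ => ((Real.sqrt ((L / 2 ^ k) ^ 3))⁻¹ : ℂ))) Ψ :=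
  rfl

/-- No particles, no coherent sum. [folklore] -/
@[simp]
theorem cohSum_zero (L : ℝ) (k : ℕ) (Ψ : Config 0 → ℂ) : cohSum 0 L k Ψ = 0 := by
  simp [cohSum, occupation]

/-- The number of cells of level `K` is `8^K`. [folklore] -/
theorem card_dyIndex (K : ℕ) : Fintype.card (Fin 3 → Fin (2 ^ K)) = 8 ^ K := by
  rw [Fintype.card_fun, Fintype.card_fin, Fintype.card_fin, ← pow_mul, mul_comm, pow_mul]
  norm_num

/-- **Pigeonhole.** If the coherent sum at level `K` is at least `a`, one of the `8^K` flat modes has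
occupation at least `a / 8^K`. [folklore] -/
theorem exists_div_le_occupation_of_le_cohSum {N : ℕ} {L : ℝ} {K : ℕ} {Ψ : Config N → ℂ} {a : ℝ≥0∞}
    (h : a ≤ cohSum N L K Ψ) : ∃ m, a / 8 ^ K ≤ occupation N (dyMode L K m) Ψ := by
  by_contra hcon
  push Not at hcon
  have hlt : cohSum N L K Ψ < ∑ _m : Fin 3 → Fin (2 ^ K), a / 8 ^ K :=
    ENNReal.sum_lt_sum_of_nonempty Finset.univ_nonempty fun m _ => hcon m
  rw [Finset.sum_const, Finset.card_univ, card_dyIndex, nsmul_eq_mul, Nat.cast_pow, Nat.cast_ofNat,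
    ENNReal.mul_div_cancel (by positivity) (ENNReal.pow_ne_top (by norm_num))] at hlt
  exact absurd h (not_le.2 hlt)

/-- **Pigeonhole, in the numerals of item `CoarsePigeonhole`.** If `F_K(Ψ) ≥ 1/2`, i.e.
`ofReal (N/2) ≤ cohSum N L K Ψ`, then some flat mode of level `K` carries `≥ N/(2·8^K)` particles.
[folklore] -/
theorem exists_le_occupation_of_half_le_cohSum {N : ℕ} {L : ℝ} {K : ℕ} {Ψ : Config N → ℂ}
    (h : ENNReal.ofReal ((N : ℝ) / 2) ≤ cohSum N L K Ψ) :
    ∃ m, ENNReal.ofReal ((N : ℝ) / (2 * 8 ^ K)) ≤ occupation N (dyMode L K m) Ψ := by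
  obtain ⟨m, hm⟩ := exists_div_le_occupation_of_le_cohSum h
  refine ⟨m, Eq.trans_le ?_ hm⟩
  rw [← div_div, ENNReal.ofReal_div_of_pos (by positivity), ENNReal.ofReal_pow (by norm_num),
    ENNReal.ofReal_ofNat]

end Literature.MathematicalPhysics.QuantumManyBody.BoseGas

end
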